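import Summits.BirchSwinnertonDyer.BirchSwinnertonDyer.Theses.PrintX10b
import Summits.BirchSwinnertonDyer.BirchSwinnertonDyer.Theorems.PrintX10bHowardContainmentAnyClassNumberX10bThm413Hyp
import Literature.NumberTheory.EllipticCurves.CastellaGrossiSkinner2025.HeegnerKolyvaginBoundAnyClassNumberProofs
import Literature.NumberTheory.EllipticCurves.HeegnerCharIdealScalingEqProofs
import Literature.NumberTheory.EllipticCurves.HeegnerCharIdealEnvelopePowTransferProofs
import Literature.NumberTheory.EllipticCurves.IwasawaAlgebraPromotionProofs
import HarnessLib

/-!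
# Line `torsion-depth-x10b-pinned`, REV-22 VARIANT (four print binders + sharpened tower, LIGHT A₃^pin) — the
# shape in which the row-10 A-side deciding crux is closable BY NAME modulo print with exactly TWO open stubs:
# a PRINT-FREE geometric envelope and the μ-INEQUALITY (x10b-p2 LEAD g2 CONSOLIDATED ASK, INBOX 2026-08-28T08:1xZ)

HONEST FRAMING: a SKELETON against LOCAL copies (§0) of route decls the pen has NOT filed (rev-22 agenda); sorries only
in `stub_envelopeGeom` / `stub_muPartTied`; nothing closed; no summit statement proved; BSD is not proved by any of this.

DESIGN (why four binders). With only {MZ, CGLS 4.1.3, Tower} (26623 as filed) two clauses the composition needs at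
`3 ∣ h_K` have no source: (a) `Λκ_∞(C) ≠ ⊥`, `𝔖` torsion-free, `𝔖/Λκ_∞(C)` torsion — CGLS 2022 Thm 4.1.1 + Cornut–Vatsal,
typed `CastellaGrossiLeeSkinner2022.thm411_torsionFree_heegnerClass_ne_bot_quotient_isTorsion` (lit p610772) — without them
every `Module.charIdeal` of a Heegner quotient may be the junk `⊤`; (b) the `(γ-1)`-free localized bound off corank one —
CGS 2025 Thm 6.5.2 any `h_K`, typed `CastellaGrossiSkinner2025.thm652_stabilized_rankOne_charIdeal_torsion_dvd_pLocalized`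
(p610515). Binding both, the envelope stub needs NO characteristic ideals and NO torsion claims: it OUTPUTS a coherent
pair `(C, F)` on the frame's `Dt` with the two MODULE inclusions `(p^e)•ℋ_F ≤ Λκ_C` and `g•Λκ_C ≤ ℋ_F` (`g ≠ 0`) —
pure CM geometry + Kummer theory (x9-p1 LEAD parts I–IV, x9-p2 K1–K3, both landed p-generically) — and the
composition turns them into `span{p^e}·I(ℋ_F) ≤ I(Λκ_C)` and `IsTorsion (𝔖/ℋ_F)` by the PROVED algebra
(`span_pow_mul_heegnerCharIdeal_le_stabilizedHeegnerCharIdeal_of_pow_smul_le` p614904,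
`isTorsion_quotient_heegnerModule_of_smul_stabilizedHeegnerModule_le`) at thm411's outputs for THAT `C`.
-/

set_option linter.dupNamespace false
set_option autoImplicit false

noncomputable section

open scoped Classical Pointwise
open Literature Literature.NumberTheory.EllipticCurves WeierstrassCurve
  Literature.NumberTheory.EllipticCurves.ModularForms
open Literature.NumberTheory.EllipticCurves.Rank1Residual (ClassX10 Surj)
open Summit.BirchSwinnertonDyer.BirchSwinnertonDyer.Theses.PrintX10b (MastellaZermanHowardDivisibility)

/-! ## §0 Local copies of the rev-22 route decls (ASKED, not filed) -/
namespace Summit.BirchSwinnertonDyer.BirchSwinnertonDyer.Theses.PrintX10bRev22Local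

/-- support (cite-only): CGLS 2022 Thm 4.1.1 + Cornut–Vatsal, structural form (lit p610772), by name. -/
def CGLSHeegnerClassNonvanishing : Prop :=
  Literature.NumberTheory.EllipticCurves.CastellaGrossiLeeSkinner2022.thm411_torsionFree_heegnerClass_ne_bot_quotient_isTorsion.{0}

/-- support (cite-only): CGS 2025 Thm 6.5.2 at any class number (p610515), by name. -/
def CGSHowardDivisibilityPLocalized : Prop :=
  Literature.NumberTheory.EllipticCurves.CastellaGrossiSkinner2025.thm652_stabilized_rankOne_charIdeal_torsion_dvd_pLocalized.{0}

/-- support (cite-only, classical CFT): the SHARPENED tower `K_k ⊆ K[p^(k+1)]` for every imaginary quadratic `K`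
and odd `p` (x9-p1 LEAD 07:05Z; lit DOSSIER §52.8 / §53.1: PR87 §3.2 at any `h_K`). -/
def AnticyclotomicTowerSharp : Prop :=
  ∀ (K : Type) [Field K] [NumberField K] (p : ℕ) [Fact p.Prime], Odd p →
    Literature.NumberTheory.EllipticCurves.IsImaginaryQuadratic K →
    ∀ (κ : Literature.NumberTheory.EllipticCurves.ZpExtension K p), κ.IsAnticyclotomic →
    ∀ (jbar : AlgebraicClosure K →+* ℂ) (k : ℕ),
      Literature.NumberTheory.EllipticCurves.ringClassSubgroup K (p ^ (k + 1)) jbar ≤ κ.layerSubgroup k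

/-- **A₃^pin (LIGHT)** — X10b twin of PrintX9's `HowardContainmentLightFramePinned` (REF 07:29:43Z concurs). -/
def HowardContainmentAnyClassNumberX10bPinnedLight : Prop :=
  ∀ (W : WeierstrassCurve ℚ) [W.IsElliptic] [W.IsGloballyMinimal] (p : ℕ) [Fact p.Prime] [NeZero (W.conductorNorm ℤ)] (K : Type) [Field K] [NumberField K], Literature.NumberTheory.EllipticCurves.Rank1Residual.ClassX10 W p → ¬ Literature.NumberTheory.EllipticCurves.Rank1Residual.Surj W 3 → ¬ W.HasCM → Literature.NumberTheory.EllipticCurves.IsImaginaryQuadratic K → Odd (NumberField.discr K) → NumberField.discr K ≠ -3 → Literature.NumberTheory.EllipticCurves.SatisfiesHeegnerHypothesis (W.conductorNorm ℤ) K → Literature.NumberTheory.EllipticCurves.SatisfiesHeegnerHypothesis p K → (W.baseChange K).HasIrreducibleModPGaloisRep p → ∀ (κ : Literature.NumberTheory.EllipticCurves.ZpExtension K p), κ.IsAnticyclotomic → ∀ (γ : Field.absoluteGaloisGroup K), κ.IsTopGenerator γ → ∀ (Dt : Literature.NumberTheory.EllipticCurves.ModularForms.ModularParametrizationData W (W.conductorNorm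 ℤ)) (H : Literature.NumberTheory.EllipticCurves.HeegnerDatum (W.conductorNorm ℤ) (NumberField.discr K)) (ιC : K →+* ℂ), ¬ (p : ℤ) ∣ Dt.c → (W.baseChange K).mordellWeilRank = 1 → Finite (AddCommGroup.primaryComponent (W.baseChange K).sha p) → ∃ (jbar : AlgebraicClosure K →+* ℂ) (D : (W.baseChange K).LambdaAdicSelmerData κ γ) (F : Literature.NumberTheory.EllipticCurves.HeegnerFamily (W.conductorNorm ℤ) W K κ jbar) (X : (W.baseChange K).SelmerDualData κ γ), F.Dt = Dt ∧ Literature.NumberTheory.EllipticCurves.heegnerCharIdeal D F ^ 2 ≤ Literature.NumberTheory.EllipticCurves.Module.charIdeal (Literature.NumberTheory.EllipticCurves.IwasawaAlgebra p) (Submodule.torsion (Literature.NumberTheory.EllipticCurves.IwasawaAlgebra p) X.X)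

/-- **The DECIDING crux (rev-22 shape asked)**: LIGHT A₃^pin from FOUR print supports + the sharpened tower. -/
def HowardContainmentAnyClassNumberX10bPinnedLightOfPrint : Prop :=
  MastellaZermanHowardDivisibility → CGLSHeegnerClassNonvanishing → CGSHowardDivisibilityPLocalized →
    AnticyclotomicTowerSharp → HowardContainmentAnyClassNumberX10bPinnedLight

end Summit.BirchSwinnertonDyer.BirchSwinnertonDyer.Theses.PrintX10bRev22Local

namespace Summit.BirchSwinnertonDyer.BirchSwinnertonDyer.Cruxes.HowardContainmentAnyClassNumberX10bPinnedOfPrint.TorsionDepthX10bPinnedV22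

open Summit.BirchSwinnertonDyer.BirchSwinnertonDyer.Theses.PrintX10bRev22Local

/-! ## §1 Stub statements (LIGHT X10b frame binders, verbatim, plus a GIVEN `jbar`) -/

/-- s_cop: the `3 ∤ h_K` regime, tied (MZ26 Cor. 4.6 by name). -/
def Stmt.coprimeTied : Prop :=
  MastellaZermanHowardDivisibility →
    ∀ (W : WeierstrassCurve ℚ) [W.IsElliptic] [W.IsGloballyMinimal] (p : ℕ) [Fact p.Prime]
      [NeZero (W.conductorNorm ℤ)] (K : Type) [Field K] [NumberField K],
      ClassX10 W p → ¬ Surj W 3 → ¬ W.HasCM →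
      IsImaginaryQuadratic K → Odd (NumberField.discr K) → NumberField.discr K ≠ -3 →
      SatisfiesHeegnerHypothesis (W.conductorNorm ℤ) K → SatisfiesHeegnerHypothesis p K →
      (W.baseChange K).HasIrreducibleModPGaloisRep p →
      ∀ (κ : ZpExtension K p), κ.IsAnticyclotomic → ∀ (γ : Field.absoluteGaloisGroup K),
      κ.IsTopGenerator γ →
      ∀ (Dt : ModularParametrizationData W (W.conductorNorm ℤ))
        (H : HeegnerDatum (W.conductorNorm ℤ) (NumberField.discr K)) (ιC : K →+* ℂ)
        (jbar : AlgebraicClosure K →+* ℂ),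
      ¬ (p : ℤ) ∣ Dt.c → (W.baseChange K).mordellWeilRank = 1 →
      Finite (AddCommGroup.primaryComponent (W.baseChange K).sha p) →
      ¬ p ∣ NumberField.classNumber K →
      ∃ (D : (W.baseChange K).LambdaAdicSelmerData κ γ)
        (F : HeegnerFamily (W.conductorNorm ℤ) W K κ jbar) (X : (W.baseChange K).SelmerDualData κ γ),
        F.Dt = Dt ∧ heegnerCharIdeal D F ^ 2 ≤
          Module.charIdeal (IwasawaAlgebra p) (Submodule.torsion (IwasawaAlgebra p) X.X)

/-- s_envGeom: the PRINT-FREE geometric envelope — from the sharpened tower, on a light X10b frame, for the GIVEN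
`jbar` and EVERY `D`: a COHERENT pair (CGLS datum `C`, Heegner family `F`) on the frame's `Dt` (one principal CM
system) and the two MODULE inclusions `(p^e)•ℋ_F ≤ Λκ_∞(C)`, `g•Λκ_∞(C) ≤ ℋ_F` with `g ≠ 0`. No characteristic
ideal, no torsion claim (those follow in the composition from the thm411 binder). Content: x9-p1 LEAD's coherent
constructors + point identities (p610688 / p611154 / p611771 / p612482 / p613479 / p614060 / part IV-d) and x9-p2's
Kummer half (p611806 / p612496 / p613491 / p613966). -/
def Stmt.envelopeGeom : Prop :=
  AnticyclotomicTowerSharp →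
    ∀ (W : WeierstrassCurve ℚ) [W.IsElliptic] [W.IsGloballyMinimal] (p : ℕ) [Fact p.Prime]
      [NeZero (W.conductorNorm ℤ)] (K : Type) [Field K] [NumberField K],
      ClassX10 W p → ¬ Surj W 3 → ¬ W.HasCM →
      IsImaginaryQuadratic K → Odd (NumberField.discr K) → NumberField.discr K ≠ -3 →
      SatisfiesHeegnerHypothesis (W.conductorNorm ℤ) K → SatisfiesHeegnerHypothesis p K →
      (W.baseChange K).HasIrreducibleModPGaloisRep p →
      ∀ (κ : ZpExtension K p), κ.IsAnticyclotomic → ∀ (γ : Field.absoluteGaloisGroup K),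
      κ.IsTopGenerator γ →
      ∀ (Dt : ModularParametrizationData W (W.conductorNorm ℤ))
        (H : HeegnerDatum (W.conductorNorm ℤ) (NumberField.discr K))
        (jbar : AlgebraicClosure K →+* ℂ) (D : (W.baseChange K).LambdaAdicSelmerData κ γ),
      ¬ (p : ℤ) ∣ Dt.c →
      ∃ (C : CastellaGrossiLeeSkinner2022.StabilizedHeegnerData (W.conductorNorm ℤ) W K κ jbar)
        (F : HeegnerFamily (W.conductorNorm ℤ) W K κ jbar) (e : ℕ) (g : IwasawaAlgebra p),
        C.Dt = Dt ∧ F.Dt = Dt ∧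
        ((p : IwasawaAlgebra p) ^ e) • heegnerModule D F ≤ CastellaGrossiLeeSkinner2022.stabilizedHeegnerModule D C ∧
        g ≠ 0 ∧ g • CastellaGrossiLeeSkinner2022.stabilizedHeegnerModule D C ≤ heegnerModule D F

/-- s_mu: the μ-part at `3 ∣ h_K` = the μ-INEQUALITY in disguise (hypothesis = everything the composition holds). -/
def Stmt.muPartTied : Prop :=
    ∀ (W : WeierstrassCurve ℚ) [W.IsElliptic] [W.IsGloballyMinimal] (p : ℕ) [Fact p.Prime]
      [NeZero (W.conductorNorm ℤ)] (K : Type) [Field K] [NumberField K],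
      ClassX10 W p → ¬ Surj W 3 → ¬ W.HasCM →
      IsImaginaryQuadratic K → Odd (NumberField.discr K) → NumberField.discr K ≠ -3 →
      SatisfiesHeegnerHypothesis (W.conductorNorm ℤ) K → SatisfiesHeegnerHypothesis p K →
      (W.baseChange K).HasIrreducibleModPGaloisRep p →
      ∀ (κ : ZpExtension K p), κ.IsAnticyclotomic → ∀ (γ : Field.absoluteGaloisGroup K),
      κ.IsTopGenerator γ →
      ∀ (Dt : ModularParametrizationData W (W.conductorNorm ℤ))
        (H : HeegnerDatum (W.conductorNorm ℤ) (NumberField.discr K)) (ιC : K →+* ℂ)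
        (jbar : AlgebraicClosure K →+* ℂ),
      ¬ (p : ℤ) ∣ Dt.c → (W.baseChange K).mordellWeilRank = 1 →
      Finite (AddCommGroup.primaryComponent (W.baseChange K).sha p) →
      p ∣ NumberField.classNumber K →
      (∃ (D : (W.baseChange K).LambdaAdicSelmerData κ γ)
          (F : HeegnerFamily (W.conductorNorm ℤ) W K κ jbar) (X : (W.baseChange K).SelmerDualData κ γ) (m : ℕ),
          F.Dt = Dt ∧ Module.Finite (IwasawaAlgebra p) D.S ∧ Module.Finite (IwasawaAlgebra p) X.X ∧
          Module.IsTorsion (IwasawaAlgebra p) (D.S ⧸ heegnerModule D F) ∧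
          Ideal.span {((p : IwasawaAlgebra p) ^ m)} * heegnerCharIdeal D F ^ 2 ≤
            Module.charIdeal (IwasawaAlgebra p) (Submodule.torsion (IwasawaAlgebra p) X.X)) →
      ∃ (D : (W.baseChange K).LambdaAdicSelmerData κ γ)
        (F : HeegnerFamily (W.conductorNorm ℤ) W K κ jbar) (X : (W.baseChange K).SelmerDualData κ γ),
        F.Dt = Dt ∧ heegnerCharIdeal D F ^ 2 ≤
          Module.charIdeal (IwasawaAlgebra p) (Submodule.torsion (IwasawaAlgebra p) X.X)

/-! ## §2 Stubs -/

/-- `d_K` odd excludes `d_K = -4`. [folklore] -/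
theorem discr_ne_neg_four_of_odd {K : Type} [Field K] [NumberField K] (hodd : Odd (NumberField.discr K)) :
    NumberField.discr K ≠ -4 := by
  rintro h; rw [h] at hodd; exact absurd hodd (by decide)

/-- **stub s_cop (PROVED; MZ26 Cor 4.6 by name at `p = 3`)**, via `X10.heegnerContainmentPinned_of_cor46_of_not_surj`
(p607508). [cite: MastellaZerman2026, Cor. 4.6 (arXiv:2505.08710)] [cite: LombardoTronto2022, Prop. 3.12] -/
theorem stub_coprimeTied : Stmt.coprimeTied := by
  intro hMZ W _ _ p _ _ K _ _ hX hns hcm hK hodd h3 hHN hHp _ κ hκ γ hγ Dt H _ jbar _ _ _ hhK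
  have h46 : MastellaZerman2026.cor46_howardDivisibility_of_scalarImage.{0} := hMZ
  obtain ⟨D, F, X, hFD, -, hle⟩ :=
    Summit.BirchSwinnertonDyer.BirchSwinnertonDyer.Rank1Residual.X10.heegnerContainmentPinned_of_cor46_of_not_surj
      h46 hX hns hcm hK h3 (discr_ne_neg_four_of_odd hodd) hHN hHp hhK κ hκ γ hγ Dt H jbar
  exact ⟨D, F, X, hFD, hle⟩

/-- **stub s_envGeom (OPEN; print-free CM geometry + Kummer theory; engine x9-p1 LEAD + x9-p2, p-generic).**
[cite: Howard2004HeegnerKolyvagin, §3.3] [cite: PerrinRiou1987BSMF, §3.3–3.4] [cite: CastellaGrossiLeeSkinner2022, §4.1, Rem. 4.1.4] -/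
theorem stub_envelopeGeom : Stmt.envelopeGeom := by
  sorry

/-- **stub s_mu (OPEN; = μ(X_tors) ≤ 2·μ(𝔖/ℋ_F) at `3 ∣ h_K`, BEYOND CITABLE PRINT per REF-118, portable)** — see
`muPartTied_of_muInequality`. [cite: MastellaZerman2026, Thm. 3.15 (iii) (standing Ass. 2.1)] [cite: CastellaGrossiLeeSkinner2022, Thm. 4.1.1] -/
theorem stub_muPartTied : Stmt.muPartTied := by
  sorry

/-- **s_mu IS the μ-INEQUALITY** (x10b-p1's sharp promotion lemma p613811).
[cite: Washington1997, §13.2] [cite: Howard2004HeegnerKolyvagin, Thm. B (c)] -/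
theorem muPartTied_of_muInequality
    (hμ : ∀ (W : WeierstrassCurve ℚ) [W.IsElliptic] [W.IsGloballyMinimal] (p : ℕ) [Fact p.Prime]
      [NeZero (W.conductorNorm ℤ)] (K : Type) [Field K] [NumberField K],
      ClassX10 W p → ¬ Surj W 3 → ¬ W.HasCM →
      IsImaginaryQuadratic K → Odd (NumberField.discr K) → NumberField.discr K ≠ -3 →
      SatisfiesHeegnerHypothesis (W.conductorNorm ℤ) K → SatisfiesHeegnerHypothesis p K →
      (W.baseChange K).HasIrreducibleModPGaloisRep p →
      ∀ (κ : ZpExtension K p), κ.IsAnticyclotomic → ∀ (γ : Field.absoluteGaloisGroup K),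
      κ.IsTopGenerator γ → ∀ (Dt : ModularParametrizationData W (W.conductorNorm ℤ)) (jbar : AlgebraicClosure K →+* ℂ),
      ¬ (p : ℤ) ∣ Dt.c → p ∣ NumberField.classNumber K →
      ∀ (D : (W.baseChange K).LambdaAdicSelmerData κ γ) (F : HeegnerFamily (W.conductorNorm ℤ) W K κ jbar)
        (X : (W.baseChange K).SelmerDualData κ γ), F.Dt = Dt →
      Module.Finite (IwasawaAlgebra p) D.S → Module.Finite (IwasawaAlgebra p) X.X →
      Module.IsTorsion (IwasawaAlgebra p) (D.S ⧸ heegnerModule D F) →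
      ∀ 𝔭 : PrimeSpectrum (IwasawaAlgebra p), 𝔭.asIdeal = Ideal.span {(p : IwasawaAlgebra p)} →
        Module.lengthAt (IwasawaAlgebra p) (Submodule.torsion (IwasawaAlgebra p) X.X) 𝔭 ≤
          2 * Module.lengthAt (IwasawaAlgebra p) (D.S ⧸ heegnerModule D F) 𝔭) :
    Stmt.muPartTied := by
  intro W _ _ p _ _ K _ _ hX hns hcm hK hodd h3 hHN hHp hirr κ hκ γ hγ Dt H ιC jbar hc hrk hfin hhK
    ⟨D, F, X, m, hFDt, hfinS, hfinX, htor, hloc⟩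
  haveI := hfinX
  haveI := hfinS
  haveI : IsNoetherian (IwasawaAlgebra p) X.X := isNoetherian_of_isNoetherianRing_of_finite _ _
  haveI : Module.Finite (IwasawaAlgebra p) (Submodule.torsion (IwasawaAlgebra p) X.X) := inferInstance
  haveI : Module.Finite (IwasawaAlgebra p) (D.S ⧸ heegnerModule D F) := inferInstance
  refine ⟨D, F, X, hFDt, ?_⟩
  exact IwasawaAlgebra.sq_charIdeal_le_charIdeal_of_span_p_pow_mul_le_of_lengthAt_le_two_mul
    (Submodule.torsion_isTorsion (R := IwasawaAlgebra p) (M := X.X)) htor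
    (hμ W p K hX hns hcm hK hodd h3 hHN hHp hirr κ hκ γ hγ Dt jbar hc hhK D F X hFDt hfinS hfinX htor) hloc

/-! ## §3 Composition (sorry-free) -/

/-- Ideal bookkeeping: `(a) · ((b) · I)² = (a·b²) · I²`. [folklore] -/
theorem span_singleton_mul_sq {R : Type*} [CommSemiring R] (a b : R) (I : Ideal R) :
    Ideal.span {a} * (Ideal.span {b} * I) ^ 2 = Ideal.span {a * b ^ 2} * I ^ 2 := by
  rw [mul_pow, Ideal.span_singleton_pow, ← mul_assoc, Ideal.span_singleton_mul_span_singleton]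

/-- Local ALIAS of the crux decl (only `…_of_stubs` concludes the crux by name, for the registry audit). -/
def Goal : Prop := HowardContainmentAnyClassNumberX10bPinnedLightOfPrint

/-- **Composition (rev-22 shape)**: fix the frame, `jbar := IsAlgClosed.lift` along `ιC`; `3 ∤ h_K` ↦ `s_cop hMZ`;
`3 ∣ h_K` ↦ `D`, `X` exist; `(C, F, e, g)` ← `s_envGeom hTw♯`; thm411 (binder `hNV`) at `(D, C)` ⇒ `𝔖` torsion-free,
`𝔖/Λκ_C` torsion ⇒ `𝔖/ℋ_F` torsion (reverse inclusion) ⇒ `span{p^e}·I(ℋ_F) ≤ I(Λκ_C)` (forward inclusion, rank one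
from thm652's clause); thm652 (binder `hCGS`) at `(D, C, X)` ⇒ `(p^m)·I(Λκ_C)² ⊆ char`; ⇒ `(p^(m+2e))·I(ℋ_F)² ⊆ char`
⇒ `s_mu`. -/
theorem HowardContainmentAnyClassNumberX10bPinnedLightOfPrint_of
    (s_cop : Stmt.coprimeTied) (s_env : Stmt.envelopeGeom) (s_mu : Stmt.muPartTied) : Goal := by
  unfold Goal
  intro hMZ hNV hCGS hTw W _ _ p _ _ K _ _ hX hns hcm hK hodd h3 hHN hHp hirr κ hκ γ hγ Dt H ιC hc hrk hfin
  letI : Algebra K ℂ := ιC.toAlgebra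
  let jbar : AlgebraicClosure K →+* ℂ :=
    (IsAlgClosed.lift (R := K) (M := ℂ) (S := AlgebraicClosure K)).toRingHom
  by_cases hhK : p ∣ NumberField.classNumber K
  · obtain ⟨D⟩ := LambdaAdicSelmerDataExists.nonempty_lambdaAdicSelmerData (W.baseChange K) p κ hγ
    obtain ⟨X⟩ := (W.baseChange K).nonempty_selmerDualData_holds κ γ hγ
    -- the print-free envelope OUTPUTS the coherent pair `(C, F)` on `Dt` with both module inclusions
    obtain ⟨C, F, e, g, -, hFDt, hle, hg, hrev⟩ :=
      s_env hTw W p K hX hns hcm hK hodd h3 hHN hHp hirr κ hκ γ hγ Dt H jbar D hc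
    have hyp := Summit.BirchSwinnertonDyer.BirchSwinnertonDyer.Rank1Residual.X10.thm413Hypotheses_of_classX10
      hX hK h3 hHN hHp hodd hκ hγ
    -- CGLS Thm. 4.1.1 + Cornut–Vatsal BY NAME at `(D, C)`: torsion-freeness of `𝔖`, torsion of `𝔖/Λκ_C`
    have h411 : CastellaGrossiLeeSkinner2022.thm411_torsionFree_heegnerClass_ne_bot_quotient_isTorsion.{0} := hNV
    obtain ⟨hfree, -, htorC⟩ := h411 (W.conductorNorm ℤ) W K p κ γ jbar hyp D C
    haveI := hfree
    -- CGS Thm. 6.5.2 BY NAME at `(D, C, X)`: finiteness / rank one of `𝔖`, finiteness of `𝒳`, the localized bound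
    have h652 : CastellaGrossiSkinner2025.thm652_stabilized_rankOne_charIdeal_torsion_dvd_pLocalized.{0} := hCGS
    obtain ⟨⟨hfinS, hS1⟩, hfinX, -⟩ := h652 (W.conductorNorm ℤ) W K p κ γ jbar hyp D C X
    haveI := hfinS
    obtain ⟨m, hm⟩ := CastellaGrossiSkinner2025.span_pow_mul_sq_le_charIdeal_torsion_of_thm652_stabilized h652
      hyp D C X
    -- torsion of `𝔖/ℋ_F` from the reverse inclusion, then the ideal envelope from the forward inclusion
    have htor : Module.IsTorsion (IwasawaAlgebra p) (D.S ⧸ heegnerModule D F) :=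
      isTorsion_quotient_heegnerModule_of_smul_stabilizedHeegnerModule_le D F C hg hrev htorC
    have henv : Ideal.span {((p : IwasawaAlgebra p) ^ e)} * heegnerCharIdeal D F ≤
        CastellaGrossiLeeSkinner2022.stabilizedHeegnerCharIdeal D C :=
      span_pow_mul_heegnerCharIdeal_le_stabilizedHeegnerCharIdeal_of_pow_smul_le D hS1 F C e hle htor
    -- `(p^(m+2e)) · I(ℋ_F)² ⊆ char(X_tors)`
    have hloc : Ideal.span {((p : IwasawaAlgebra p) ^ (m + e * 2))} * heegnerCharIdeal D F ^ 2 ≤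
        Module.charIdeal (IwasawaAlgebra p) (Submodule.torsion (IwasawaAlgebra p) X.X) := by
      calc Ideal.span {((p : IwasawaAlgebra p) ^ (m + e * 2))} * heegnerCharIdeal D F ^ 2
          = Ideal.span {((p : IwasawaAlgebra p) ^ m)} *
              (Ideal.span {((p : IwasawaAlgebra p) ^ e)} * heegnerCharIdeal D F) ^ 2 := by
            rw [span_singleton_mul_sq, ← pow_mul, ← pow_add]
        _ ≤ Ideal.span {((p : IwasawaAlgebra p) ^ m)} *
              CastellaGrossiLeeSkinner2022.stabilizedHeegnerCharIdeal D C ^ 2 :=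
            Ideal.mul_mono_right (Ideal.pow_right_mono henv 2)
        _ ≤ _ := hm
    obtain ⟨D', F', X', hF', hle'⟩ := s_mu W p K hX hns hcm hK hodd h3 hHN hHp hirr κ hκ γ hγ Dt H ιC jbar hc hrk
      hfin hhK ⟨D, F, X, m + e * 2, hFDt, hfinS, hfinX, htor, hloc⟩
    exact ⟨jbar, D', F', X', hF', hle'⟩
  · obtain ⟨D, F, X, hF, hle⟩ := s_cop hMZ W p K hX hns hcm hK hodd h3 hHN hHp hirr κ hκ γ hγ Dt H ιC jbar hc hrk
      hfin hhK
    exact ⟨jbar, D, F, X, hF, hle⟩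

/-- the composed line (sorries only through `stub_envelopeGeom`, `stub_muPartTied`). -/
theorem HowardContainmentAnyClassNumberX10bPinnedLightOfPrint_of_stubs : HowardContainmentAnyClassNumberX10bPinnedLightOfPrint :=
  (HowardContainmentAnyClassNumberX10bPinnedLightOfPrint_of stub_coprimeTied stub_envelopeGeom stub_muPartTied : Goal)

end Summit.BirchSwinnertonDyer.BirchSwinnertonDyer.Cruxes.HowardContainmentAnyClassNumberX10bPinnedOfPrint.TorsionDepthX10bPinnedV22

end
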